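import Mathlib
import Summits.Ventures.HodgeRepro2.T6A1WeilProjector

/-!
# T6A1WeilDescent — the Weil projector over `F` and its descent to `ℚ` (Prop. A2.3 (i), (ii), (iv))

Tier-6 sub-goal A1 (route/T6-A1-t6-p1.md §1 (A1.iii), §3 layer L2), continuation of
`T6A1WeilProjector`: with the separating `x` and the rational Lagrange polynomial `Q` of that file,
`e_F := P(⋀^n(x ⊗ 1))` is the projector of `⋀[F]^n (F ⊗ V)` onto the Weil summand `⊕_σ ⋀^n V_σ`
(p7's `eigenSummand`), and `p_W := Q([x]^*)` on `⋀[ℚ]^n V` is its rational form: an idempotent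
whose range base-changes to the Weil summand (p7's `eigenSummandK`, the descended Weil line `W₀`),
has `ℚ`-dimension `[F : ℚ]` (Prop. A2.3(iv)), and maps every `[x]^*`-stable subspace `A` (the
algebraic classes, Prop. A2.3(ii)) into `A ⊓ W_F(B)`. The base-change bookkeeping («an identity of
`ℚ`-linear maps may be checked after `⊗ℂ`») runs through p7's `A1ExteriorBaseChange.baseChangeEquiv`
and `A1BaseChange`.
-/

namespace Summit.Ventures.HodgeRepro2.T6.A1WeilDescent

open Polynomial A1WeilProjector
open scoped TensorProduct

variable (F : Type*) [Field F] [Algebra ℚ F] [FiniteDimensional ℚ F]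
variable (V : Type*) [AddCommGroup V] [Module ℚ V] [Module F V] [IsScalarTower ℚ F V]
variable [DecidableEq (F →ₐ[ℚ] F)] [DecidableEq F]

section Projector
variable [IsGalois ℚ F]

/-- The projector over `F`: `e_F := P(⋀^n(x ⊗ 1))`, the projector of `⋀[F]^n (F ⊗ V)` onto the Weil
summand `⊕_σ ⋀^n V_σ` along the non-Weil pieces. -/
noncomputable def eF (n : ℕ) (x : F) : Module.End F (⋀[F]^n (F ⊗[ℚ] V)) :=
  aeval (TF F V n x) (lagrangeP F n x)

omit [FiniteDimensional ℚ F] [IsGalois ℚ F] [DecidableEq F] in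
/-- The Weil index `n·e_σ` as a natural-number vector. -/
theorem weilIdx_val (n : ℕ) (σ : F →ₐ[ℚ] F) :
    (fun τ => (weilIdx F n σ τ : ℕ)) = Pi.single σ n := by
  funext τ
  by_cases h : τ = σ <;> simp [weilIdx, h]

omit [FiniteDimensional ℚ F] [IsGalois ℚ F] [DecidableEq F] in
/-- p7's Weil summand `eigenSummand = ⊕_σ ⋀^n V_σ` is the sum of the Weil pieces `H^{(n e_σ)}`. -/
theorem eigenSummand_eq_iSup_piece (n : ℕ) :
    A1SplitSummandDescent.eigenSummand ℚ F F V n =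
      ⨆ σ, A1Monomials.piece (U F V) n fun τ => (weilIdx F n σ τ : ℕ) := by
  rw [A1DescendedBijection.eigenSummand_eq_iSup]
  refine iSup_congr fun σ => ?_
  rw [weilIdx_val, A1Monomials.piece_single]

variable (n : ℕ) (x : F) (hx : Function.Injective (chi F n x))
include hx

/-- `e_F` acts on the piece `H^{(k)}` as `1` if `k` is a Weil index and as `0` otherwise
(Prop. A2.3(i), first sentence). -/
theorem eF_apply_of_mem_piece (k : (F →ₐ[ℚ] F) → Fin (n + 1)) {v : ⋀[F]^n (F ⊗[ℚ] V)}
    (hv : v ∈ A1Monomials.piece (U F V) n fun σ => (k σ : ℕ)) :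
    eF F V n x v = (if ∃ σ, k = weilIdx F n σ then (1 : F) else 0) • v := by
  unfold eF
  rw [(eigenDataF F V n x hx).aeval_apply_eq_smul k hv, eval_lagrangeP F n x hx k]

/-- `e_F` is the identity on the Weil summand. -/
theorem eF_apply_of_mem_eigenSummand {v : ⋀[F]^n (F ⊗[ℚ] V)}
    (hv : v ∈ A1SplitSummandDescent.eigenSummand ℚ F F V n) : eF F V n x v = v := by
  rw [eigenSummand_eq_iSup_piece] at hv
  refine Submodule.iSup_induction (motive := fun w => eF F V n x w = w) _ hv
    (fun σ v hv => ?_) (map_zero _) (fun v w hv hw => by rw [map_add, hv, hw])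
  rw [eF_apply_of_mem_piece F V n x hx (weilIdx F n σ) hv, if_pos ⟨σ, rfl⟩, one_smul]

/-- `e_F` takes values in the Weil summand. -/
theorem eF_apply_mem (v : ⋀[F]^n (F ⊗[ℚ] V)) :
    eF F V n x v ∈ A1SplitSummandDescent.eigenSummand ℚ F F V n := by
  have hv : v ∈ ⨆ k : (F →ₐ[ℚ] F) → Fin (n + 1),
      A1Monomials.piece (U F V) n fun σ => (k σ : ℕ) := by
    rw [(eigenDataF F V n x hx).iSup_eq_top]
    exact Submodule.mem_top
  refine Submodule.iSup_induction
    (motive := fun w => eF F V n x w ∈ A1SplitSummandDescent.eigenSummand ℚ F F V n) _ hv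
    (fun k v hv => ?_) (by rw [map_zero]; exact zero_mem _)
    (fun v w hv hw => by rw [map_add]; exact add_mem hv hw)
  rw [eF_apply_of_mem_piece F V n x hx k hv]
  split_ifs with h
  · obtain ⟨σ, rfl⟩ := h
    rw [one_smul, eigenSummand_eq_iSup_piece]
    exact Submodule.mem_iSup_of_mem σ hv
  · rw [zero_smul]
    exact zero_mem _

/-- `e_F` is idempotent. -/
theorem eF_eF (v : ⋀[F]^n (F ⊗[ℚ] V)) : eF F V n x (eF F V n x v) = eF F V n x v :=
  eF_apply_of_mem_eigenSummand F V n x hx (eF_apply_mem F V n x hx v)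

/-- The range of `e_F` is the Weil summand `⊕_σ ⋀^n V_σ`. -/
theorem range_eF : LinearMap.range (eF F V n x) = A1SplitSummandDescent.eigenSummand ℚ F F V n := by
  apply le_antisymm
  · rintro _ ⟨v, rfl⟩
    exact eF_apply_mem F V n x hx v
  · intro v hv
    exact ⟨v, eF_apply_of_mem_eigenSummand F V n x hx hv⟩

omit hx
variable {I : Type*} [LinearOrder I] (b : Module.Basis I ℚ V)

omit [FiniteDimensional ℚ F] [IsGalois ℚ F] [DecidableEq F] [DecidableEq (F →ₐ[ℚ] F)] in
/-- Under p7's `baseChangeEquiv`, the base change of `[x]^*` is conjugate to `⋀^n(x ⊗ 1)`. -/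
theorem conjAlgEquiv_baseChange_T :
    (A1ExteriorBaseChange.baseChangeEquiv ℚ F V n b).conjAlgEquiv F
      (LinearMap.baseChange F (T F V n x)) = TF F V n x := by
  rw [LinearEquiv.conjAlgEquiv_apply]
  apply LinearMap.ext
  intro w
  obtain ⟨v, rfl⟩ := (A1ExteriorBaseChange.baseChangeEquiv ℚ F V n b).surjective w
  have := LinearMap.congr_fun (baseChangeMap_comp_baseChange_T F V n x) v
  simp only [LinearMap.comp_apply] at this
  simp only [LinearMap.comp_apply, LinearEquiv.coe_coe, LinearEquiv.symm_apply_apply]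
  rw [A1ExteriorBaseChange.baseChangeEquiv_apply, A1ExteriorBaseChange.baseChangeEquiv_apply, this]

omit [FiniteDimensional ℚ F] [IsGalois ℚ F] [DecidableEq F] [DecidableEq (F →ₐ[ℚ] F)] in
/-- Base change of a rational polynomial in `[x]^*` is the same polynomial in `⋀^n(x ⊗ 1)`, through
`baseChangeEquiv` (the prose's «an identity of `ℚ`-linear maps may be checked after `⊗ℂ`»). -/
theorem baseChangeEquiv_aeval (Q : ℚ[X]) (v : F ⊗[ℚ] ⋀[ℚ]^n V) :
    A1ExteriorBaseChange.baseChangeEquiv ℚ F V n b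
        (LinearMap.baseChange F (aeval (T F V n x) Q) v) =
      aeval (TF F V n x) (Q.map (algebraMap ℚ F))
        (A1ExteriorBaseChange.baseChangeEquiv ℚ F V n b v) := by
  have h1 : LinearMap.baseChange F (aeval (T F V n x) Q) =
      aeval (LinearMap.baseChange F (T F V n x)) (Q.map (algebraMap ℚ F)) := by
    rw [Polynomial.aeval_map_algebraMap]
    exact (Polynomial.aeval_algHom_apply (Module.End.baseChangeHom ℚ F _) (T F V n x) Q).symm
  rw [h1, ← conjAlgEquiv_baseChange_T F V n x b, Polynomial.aeval_algEquiv]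
  simp only [AlgHom.coe_comp, AlgEquiv.coe_toAlgHom, Function.comp_apply,
    LinearEquiv.conjAlgEquiv_apply, LinearMap.comp_apply, LinearEquiv.coe_coe,
    LinearEquiv.symm_apply_apply]

/-- PROPOSITION A2.3 (i), (ii), (iv), carrier-free (route/T6-A1-t6-p1.md §1 (A1.iii)): for `F/ℚ`
finite Galois and `V` a finite-dimensional `F`-space there are `x ∈ F` and `Q ∈ ℚ[X]` such that
`p_W := Q([x]^*)` on `⋀[ℚ]^n V` is an idempotent, its range base-changes to the Weil summand
`⊕_σ ⋀^n V_σ` (p7's `eigenSummandK`, the descended Weil line `W₀`), and `p_W` maps every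
`[x]^*`-stable subspace `A` (the algebraic classes) into `A ⊓ range p_W`. -/
theorem exists_weilProjector [FiniteDimensional F V] :
    ∃ (x : F) (Q : ℚ[X]),
      IsIdempotentElem (aeval (T F V n x) Q) ∧
      Submodule.baseChange F (LinearMap.range (aeval (T F V n x) Q)) =
        A1SplitSummandDescent.eigenSummandK ℚ F F V n b ∧
      ∀ A : Submodule ℚ (⋀[ℚ]^n V), (∀ v ∈ A, T F V n x v ∈ A) →
        ∀ v ∈ A, aeval (T F V n x) Q v ∈ A ⊓ LinearMap.range (aeval (T F V n x) Q) := by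
  obtain ⟨x, hx⟩ := exists_separating_chi F n
  obtain ⟨Q, hQ⟩ := exists_rat_lagrangeP F n x
  have heF : aeval (TF F V n x) (Q.map (algebraMap ℚ F)) = eF F V n x := by
    rw [hQ]
    rfl
  have key : ∀ v, A1ExteriorBaseChange.baseChangeEquiv ℚ F V n b
      (LinearMap.baseChange F (aeval (T F V n x) Q) v) =
        eF F V n x (A1ExteriorBaseChange.baseChangeEquiv ℚ F V n b v) := by
    intro v
    rw [baseChangeEquiv_aeval, heF]
  refine ⟨x, Q, ?_, ?_, ?_⟩
  · -- idempotent, checked after base change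
    apply A1BaseChange.baseChange_inj (K := F)
    rw [LinearMap.baseChange_mul]
    apply LinearMap.ext
    intro v
    apply (A1ExteriorBaseChange.baseChangeEquiv ℚ F V n b).injective
    rw [Module.End.mul_apply, key, key, eF_eF F V n x hx]
  · -- the range descends to the Weil summand
    rw [← A1BaseChange.range_baseChange, A1SplitSummandDescent.eigenSummandK]
    ext v
    rw [Submodule.mem_comap, LinearMap.mem_range]
    constructor
    · rintro ⟨w, rfl⟩
      rw [LinearEquiv.coe_coe, key]
      exact eF_apply_mem F V n x hx _
    · intro hv
      refine ⟨v, ?_⟩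
      apply (A1ExteriorBaseChange.baseChangeEquiv ℚ F V n b).injective
      rw [key]
      exact eF_apply_of_mem_eigenSummand F V n x hx hv
  · intro A hA v hv
    exact ⟨BridgeProjector.aeval_apply_mem_of_stable A hA Q hv, ⟨v, rfl⟩⟩

/-- Prop. A2.3(iv), the dimension: for `n = rank_F V` the range of `p_W` has `ℚ`-dimension `[F : ℚ]`
(«`dim_ℚ W_F(B) = 6`»; p7's `A1DescendedBijection.finrank_descended_top`). -/
theorem exists_weilProjector_top [FiniteDimensional F V] [NeZero (Module.finrank F V)] :
    ∃ (x : F) (Q : ℚ[X]),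
      IsIdempotentElem (aeval (T F V (Module.finrank F V) x) Q) ∧
      Submodule.baseChange F (LinearMap.range (aeval (T F V (Module.finrank F V) x) Q)) =
        A1SplitSummandDescent.eigenSummandK ℚ F F V (Module.finrank F V) b ∧
      Module.finrank ℚ (LinearMap.range (aeval (T F V (Module.finrank F V) x) Q)) =
        Module.finrank ℚ F ∧
      ∀ A : Submodule ℚ (⋀[ℚ]^(Module.finrank F V) V),
        (∀ v ∈ A, T F V (Module.finrank F V) x v ∈ A) →
        ∀ v ∈ A, aeval (T F V (Module.finrank F V) x) Q v ∈
          A ⊓ LinearMap.range (aeval (T F V (Module.finrank F V) x) Q) := by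
  obtain ⟨x, Q, h1, h2, h3⟩ := exists_weilProjector F V (Module.finrank F V) b
  exact ⟨x, Q, h1, h2, A1DescendedBijection.finrank_descended_top ℚ F V b _ h2, h3⟩

end Projector

end Summit.Ventures.HodgeRepro2.T6.A1WeilDescent
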